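import Literature.Analysis.Pluripotential.RegularLocusLeviForm
import Literature.Analysis.Pluripotential.FubiniStudyLeviMatrix
import Mathlib.Analysis.Calculus.BumpFunction.Convolution
import Mathlib.Analysis.Calculus.BumpFunction.FiniteDimension
import Mathlib.Analysis.Calculus.ContDiff.Convolution
import HarnessLib

/-!
# Mollification preserves the sub-mean-value property (regularisation of psh functions, smooth side)

Topic `Literature/Analysis/Pluripotential`; step (P4a) of the proof of the named fact
`BoucksomEtAl2010_regularMass_le_degree_pow` (`NonPluripolarMongeAmpereMass.lean`). For a locally
integrable `g : ℂᴺ → ℝ` which satisfies, at almost every point `z`, the sub-mean-value inequality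
`g z ≤ (2π)⁻¹∫ g(z + re^{iθ}ξ) dθ` on every circle of every complex line (with circle integrability)
— e.g. the chart potential of a closed positive `(1,1)`-current (`ChartPotentialIntegrability.lean`)
— and a normed bump `ρ = φ.normed` (Mathlib `ContDiffBump`), the mollification
`g_φ = ρ ⋆ g` (Mathlib `MeasureTheory.convolution` with `lsmul ℝ ℝ`):

* `contDiff_normed_convolution` — `g_φ` is `C^∞` (`HasCompactSupport.contDiff_convolution_left`);
* `integrable_normed_mul_comp_circleMap` — joint integrability of `(θ, t) ↦ ρ(t) g(x + re^{iθ}ξ -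
    t)`
  on `(0,2π] × ℂᴺ` (shear `MeasurePreserving.skew_product`, local integrability on a big ball);
* `normed_convolution_le_circleAverage` — **`g_φ` satisfies the sub-mean-value inequality at EVERY
  point** (translate the a.e. inequality, integrate against `ρ ≥ 0`, Fubini);
* `posSemidef_leviMatrix_normed_convolution`, `heightDensity_normed_convolution_nonneg` — hence its
  Levi matrix is positive semidefinite and all its Monge–Ampère densities are `≥ 0` everywhere
  (`RegularLocusLeviForm.posSemidef_leviMatrix_of_contDiffAt`, `FubiniStudyLeviMatrix`);
* `fsPotential_sub_le`, `normed_convolution_le_fsPotential` — growth: `g ≤ c·fs + C₀` implies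
  `g_φ ≤ c·fs + C₀ + c log(2(1+N))/2` for `φ.rOut ≤ 1`.

## References

* [HormanderSCV1973] L. Hörmander, An introduction to complex analysis in several variables (1973),
  Thm. 1.6.3, Thm. 2.6.3 (regularisation `u ⋆ φ_ε` of psh functions is psh and smooth).
-/

noncomputable section

open scoped Topology ENNReal Convolution ContDiff ComplexOrder
open MeasureTheory Filter Set Metric Complex ContinuousLinearMap
open Literature.AlgebraicGeometry.HodgeTheory.BiextensionHeight (leviMatrix fsPotential
    heightDensity)

namespace Literature.Analysis.Pluripotential

variable {N : ℕ}

/-- **Mollifications of locally integrable functions are smooth.** [folklore] -/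
theorem contDiff_normed_convolution (φ : ContDiffBump (0 : Fin N → ℂ)) {g : (Fin N → ℂ) → ℝ}
    (hg : LocallyIntegrable g volume) :
    ContDiff ℝ ∞ (φ.normed volume ⋆[lsmul ℝ ℝ, volume] g) :=
  φ.hasCompactSupport_normed.contDiff_convolution_left _ φ.contDiff_normed hg

/-- A normed bump function is bounded. [folklore] -/
theorem exists_normed_le (φ : ContDiffBump (0 : Fin N → ℂ)) :
    ∃ B : ℝ, 0 ≤ B ∧ ∀ t, φ.normed volume t ≤ B := by
  obtain ⟨C, hC⟩ := (φ.continuous_normed (μ := volume)).bounded_above_of_compact_support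
    φ.hasCompactSupport_normed
  refine ⟨max C 0, le_max_right _ _, fun t ↦ ?_⟩
  have := hC t
  rw [Real.norm_eq_abs, abs_of_nonneg (φ.nonneg_normed t)] at this
  exact this.trans (le_max_left _ _)

/-- **The joint integrability behind the sub-mean-value property of mollifications**: for `g`
locally integrable, `(θ, t) ↦ ρ(t) g(x + r e^{iθ} ξ - t)` is integrable on `(0, 2π] × ℂᴺ`.
[folklore] -/
theorem integrable_normed_mul_comp_circleMap (φ : ContDiffBump (0 : Fin N → ℂ))
    {g : (Fin N → ℂ) → ℝ} (hg : LocallyIntegrable g volume) (x ξ : Fin N → ℂ) (r : ℝ) :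
    Integrable (fun p : ℝ × (Fin N → ℂ) ↦
      φ.normed volume p.2 * g (x + circleMap 0 r p.1 • ξ - p.2))
      ((volume.restrict (Ioc (0 : ℝ) (2 * Real.pi))).prod volume) := by
  set ν : Measure ℝ := volume.restrict (Ioc (0 : ℝ) (2 * Real.pi)) with hν
  haveI : IsFiniteMeasure ν := ⟨by rw [hν, Measure.restrict_apply_univ]; exact measure_Ioc_lt_top⟩
  set c : ℝ → Fin N → ℂ := fun θ ↦ x + circleMap 0 r θ • ξ with hc
  have hcont_c : Continuous c := by fun_prop
  -- the shear `(θ, t) ↦ (θ, c θ - t)` preserves `ν × λ`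
  have hshear : MeasurePreserving (fun p : ℝ × (Fin N → ℂ) ↦ (p.1, c p.1 - p.2))
      (ν.prod volume) (ν.prod volume) := by
    refine (MeasurePreserving.id ν).skew_product (g := fun θ t ↦ c θ - t) ?_ ?_
    · exact (hcont_c.comp continuous_fst).sub continuous_snd |>.measurable
    · exact Eventually.of_forall fun θ ↦ (Measure.measurePreserving_sub_left volume (c θ)).map_eq
  -- measurability
  have hqmp : Measure.QuasiMeasurePreserving (fun p : ℝ × (Fin N → ℂ) ↦ c p.1 - p.2)
      (ν.prod volume) volume := by
    have h := (Measure.quasiMeasurePreserving_snd (μ := ν) (ν := (volume : Measure (Fin N →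
        ℂ)))).comp
      hshear.quasiMeasurePreserving
    exact h
  have hmeas : AEStronglyMeasurable (fun p : ℝ × (Fin N → ℂ) ↦
      φ.normed volume p.2 * g (c p.1 - p.2)) (ν.prod volume) :=
    (φ.continuous_normed.comp continuous_snd).aestronglyMeasurable.mul
      (hg.aestronglyMeasurable.comp_quasiMeasurePreserving hqmp)
  -- domination on the `t`-slices
  obtain ⟨B, hB0, hB⟩ := exists_normed_le φ
  set R₀ : ℝ := |r| * ‖ξ‖ + φ.rOut with hR₀
  have hI : ∀ θ, ∫ t, ‖φ.normed volume t * g (c θ - t)‖ ≤ B * ∫ s in closedBall x R₀, ‖g s‖ := by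
    intro θ
    have hsub : closedBall (c θ) φ.rOut ⊆ closedBall x R₀ := by
      intro s hs
      rw [mem_closedBall, dist_eq_norm] at hs ⊢
      calc ‖s - x‖ = ‖(s - c θ) + circleMap 0 r θ • ξ‖ := by
            rw [← sub_add_sub_cancel s (c θ) x, show c θ - x = circleMap 0 r θ • ξ by simp [hc]]
        _ ≤ ‖s - c θ‖ + ‖circleMap 0 r θ • ξ‖ := norm_add_le _ _
        _ ≤ φ.rOut + |r| * ‖ξ‖ := by
            gcongr
            rw [norm_smul, norm_circleMap_zero]
        _ = R₀ := by rw [hR₀]; ring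
    calc ∫ t, ‖φ.normed volume t * g (c θ - t)‖
        ≤ ∫ t, B * (closedBall (c θ) φ.rOut).indicator (fun s ↦ ‖g s‖) (c θ - t) := by
          refine integral_mono_of_nonneg (Eventually.of_forall fun t ↦ norm_nonneg _) ?_
            (Eventually.of_forall fun t ↦ ?_)
          · refine Integrable.const_mul ?_ B
            have hio : IntegrableOn (fun s ↦ ‖g s‖) (closedBall (c θ) φ.rOut) :=
              (hg.integrableOn_isCompact (isCompact_closedBall (c θ) φ.rOut)).norm
            exact (hio.integrable_indicator measurableSet_closedBall).comp_sub_left (c θ)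
          · show ‖φ.normed volume t * g (c θ - t)‖ ≤
              B * (closedBall (c θ) φ.rOut).indicator (fun s ↦ ‖g s‖) (c θ - t)
            rw [norm_mul, Real.norm_eq_abs, abs_of_nonneg (φ.nonneg_normed t)]
            by_cases ht : t ∈ ball (0 : Fin N → ℂ) φ.rOut
            · rw [indicator_of_mem]
              · exact mul_le_mul_of_nonneg_right (hB t) (norm_nonneg _)
              · rw [mem_closedBall, dist_eq_norm, sub_sub_cancel_left, norm_neg]
                exact (mem_ball_zero_iff.mp ht).le
            · have h0 : φ.normed volume t = 0 := by
                have : t ∉ Function.support (φ.normed volume) := by rwa [φ.support_normed_eq]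
                simpa using this
              rw [h0, zero_mul]
              exact mul_nonneg hB0 (indicator_nonneg (fun _ _ ↦ norm_nonneg _) _)
      _ = B * ∫ s in closedBall (c θ) φ.rOut, ‖g s‖ := by
          rw [integral_const_mul, integral_sub_left_eq_self
            ((closedBall (c θ) φ.rOut).indicator fun s ↦ ‖g s‖) volume (c θ),
            integral_indicator measurableSet_closedBall]
      _ ≤ B * ∫ s in closedBall x R₀, ‖g s‖ :=
          mul_le_mul_of_nonneg_left (setIntegral_mono_set
            ((hg.integrableOn_isCompact (isCompact_closedBall x R₀)).norm)
            (Eventually.of_forall fun _ ↦ norm_nonneg _) (Eventually.of_forall hsub)) hB0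
  -- conclude by `integrable_prod_iff`
  rw [show (fun p : ℝ × (Fin N → ℂ) ↦ φ.normed volume p.2 * g (x + circleMap 0 r p.1 • ξ - p.2)) =
    fun p ↦ φ.normed volume p.2 * g (c p.1 - p.2) from rfl]
  rw [integrable_prod_iff hmeas]
  refine ⟨Eventually.of_forall fun θ ↦ ?_, ?_⟩
  · exact (φ.hasCompactSupport_normed.convolutionExists_left (lsmul ℝ ℝ) φ.continuous_normed hg)
      (c θ)
  · refine Integrable.mono' (integrable_const (B * ∫ s in closedBall x R₀, ‖g s‖))
      hmeas.norm.integral_prod_right' (Eventually.of_forall fun θ ↦ ?_)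
    rw [Real.norm_eq_abs, abs_of_nonneg (integral_nonneg fun _ ↦ norm_nonneg _)]
    exact hI θ


/-- **Mollification preserves the sub-mean-value property.** If `g` is locally integrable and
satisfies, at almost every point, the sub-mean-value inequality on every circle of every complex
line through it (with circle integrability), then `ρ ⋆ g` satisfies the sub-mean-value inequality
at EVERY point: `(ρ⋆g)(x) = ∫ρ(t)g(x-t) ≤ ∫ρ(t)⨍g(x-t+re^{iθ}ξ) = ⨍(ρ⋆g)(x+re^{iθ}ξ)` (Fubini).
[cite: HormanderSCV1973, Thm. 1.6.3 and Thm. 2.6.3 (regularisation of psh functions)] -/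
theorem normed_convolution_le_circleAverage (φ : ContDiffBump (0 : Fin N → ℂ))
    {g : (Fin N → ℂ) → ℝ} (hg : LocallyIntegrable g volume)
    (hsmv : ∀ᵐ z : Fin N → ℂ, ∀ (ξ : Fin N → ℂ) (r : ℝ), 0 < r →
      CircleIntegrable (fun τ : ℂ ↦ g (z + τ • ξ)) 0 r ∧
        g z ≤ Real.circleAverage (fun τ : ℂ ↦ g (z + τ • ξ)) 0 r)
    (x ξ : Fin N → ℂ) {r : ℝ} (hr : 0 < r) :
    (φ.normed volume ⋆[lsmul ℝ ℝ, volume] g) x ≤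
      Real.circleAverage (fun τ : ℂ ↦ (φ.normed volume ⋆[lsmul ℝ ℝ, volume] g) (x + τ • ξ)) 0 r :=
          by
  set ρ := φ.normed volume with hρ
  -- the a.e. inequality at the translated points `x - t`
  have hae : ∀ᵐ t : Fin N → ℂ, ρ t * g (x - t) ≤
      ρ t * Real.circleAverage (fun τ : ℂ ↦ g (x - t + τ • ξ)) 0 r := by
    have h := (Measure.measurePreserving_sub_left volume x).quasiMeasurePreserving.ae hsmv
    filter_upwards [h] with t ht
    exact mul_le_mul_of_nonneg_left (ht ξ r hr).2 (φ.nonneg_normed t)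
  -- joint integrability
  have hint := integrable_normed_mul_comp_circleMap φ hg x ξ r
  set ν : Measure ℝ := volume.restrict (Ioc (0 : ℝ) (2 * Real.pi)) with hν
  have hFub : ∫ t, ∫ θ in Ioc (0 : ℝ) (2 * Real.pi), ρ t * g (x + circleMap 0 r θ • ξ - t) =
      ∫ θ in Ioc (0 : ℝ) (2 * Real.pi), ∫ t, ρ t * g (x + circleMap 0 r θ • ξ - t) := by
    rw [integral_integral_swap]
    exact hint.swap
  -- the integral of the averages
  have hpi : 0 < 2 * Real.pi := Real.two_pi_pos
  have havg : ∀ t, ρ t * Real.circleAverage (fun τ : ℂ ↦ g (x - t + τ • ξ)) 0 r =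
      (2 * Real.pi)⁻¹ * ∫ θ in Ioc (0 : ℝ) (2 * Real.pi), ρ t * g (x + circleMap 0 r θ • ξ - t) :=
          by
    intro t
    rw [Real.circleAverage_def, intervalIntegral.integral_of_le hpi.le, smul_eq_mul, ← mul_assoc,
      mul_comm (ρ t), mul_assoc, ← integral_const_mul]
    congr 1
    refine integral_congr_ae (Eventually.of_forall fun θ ↦ ?_)
    simp only [sub_add_eq_add_sub]
  have hrhs_int : Integrable fun t ↦ ∫ θ in Ioc (0 : ℝ) (2 * Real.pi),
      ρ t * g (x + circleMap 0 r θ • ξ - t) := hint.swap.integral_prod_left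
  calc (ρ ⋆[lsmul ℝ ℝ, volume] g) x = ∫ t, ρ t * g (x - t) := convolution_lsmul
    _ ≤ ∫ t, ρ t * Real.circleAverage (fun τ : ℂ ↦ g (x - t + τ • ξ)) 0 r := by
        refine integral_mono_ae ?_ ?_ hae
        · exact φ.hasCompactSupport_normed.convolutionExists_left (lsmul ℝ ℝ) φ.continuous_normed
            hg x
        · rw [show (fun t ↦ ρ t * Real.circleAverage (fun τ : ℂ ↦ g (x - t + τ • ξ)) 0 r) =
            fun t ↦ (2 * Real.pi)⁻¹ * ∫ θ in Ioc (0 : ℝ) (2 * Real.pi),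
              ρ t * g (x + circleMap 0 r θ • ξ - t) from funext havg]
          exact hrhs_int.const_mul _
    _ = (2 * Real.pi)⁻¹ * ∫ t, ∫ θ in Ioc (0 : ℝ) (2 * Real.pi),
          ρ t * g (x + circleMap 0 r θ • ξ - t) := by
        rw [show (fun t ↦ ρ t * Real.circleAverage (fun τ : ℂ ↦ g (x - t + τ • ξ)) 0 r) =
          fun t ↦ (2 * Real.pi)⁻¹ * ∫ θ in Ioc (0 : ℝ) (2 * Real.pi),
            ρ t * g (x + circleMap 0 r θ • ξ - t) from funext havg]
        exact integral_const_mul _ _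
    _ = (2 * Real.pi)⁻¹ * ∫ θ in Ioc (0 : ℝ) (2 * Real.pi),
          (ρ ⋆[lsmul ℝ ℝ, volume] g) (x + circleMap 0 r θ • ξ) := by
        rw [hFub]
        rfl
    _ = Real.circleAverage (fun τ : ℂ ↦ (ρ ⋆[lsmul ℝ ℝ, volume] g) (x + τ • ξ)) 0 r := by
        rw [Real.circleAverage_def, intervalIntegral.integral_of_le hpi.le, smul_eq_mul]

/-- **Mollifications of a.e.-sub-mean-value functions have positive semidefinite Levi matrices
everywhere** (they are smooth and psh). [cite: HormanderSCV1973, Thm. 2.6.3] -/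
theorem posSemidef_leviMatrix_normed_convolution (φ : ContDiffBump (0 : Fin N → ℂ))
    {g : (Fin N → ℂ) → ℝ} (hg : LocallyIntegrable g volume)
    (hsmv : ∀ᵐ z : Fin N → ℂ, ∀ (ξ : Fin N → ℂ) (r : ℝ), 0 < r →
      CircleIntegrable (fun τ : ℂ ↦ g (z + τ • ξ)) 0 r ∧
        g z ≤ Real.circleAverage (fun τ : ℂ ↦ g (z + τ • ξ)) 0 r)
    (w : Fin N → ℂ) : (leviMatrix (φ.normed volume ⋆[lsmul ℝ ℝ, volume] g) w).PosSemidef := by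
  have hC := contDiff_normed_convolution φ hg
  refine posSemidef_leviMatrix_of_contDiffAt (hC.contDiffAt.of_le (WithTop.coe_le_coe.mpr le_top))
    fun ξ ↦ ?_
  have : ∀ᶠ r in 𝓝[>] (0 : ℝ), (φ.normed volume ⋆[lsmul ℝ ℝ, volume] g) w ≤
      Real.circleAverage (fun τ : ℂ ↦ (φ.normed volume ⋆[lsmul ℝ ℝ, volume] g) (w + τ • ξ)) 0 r :=
          by
    filter_upwards [self_mem_nhdsWithin] with r hr
    exact normed_convolution_le_circleAverage φ hg hsmv w ξ hr
  exact this.frequently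

/-- Hence all the height densities of a mollification are non-negative everywhere. [folklore] -/
theorem heightDensity_normed_convolution_nonneg (φ : ContDiffBump (0 : Fin N → ℂ))
    {g : (Fin N → ℂ) → ℝ} (hg : LocallyIntegrable g volume)
    (hsmv : ∀ᵐ z : Fin N → ℂ, ∀ (ξ : Fin N → ℂ) (r : ℝ), 0 < r →
      CircleIntegrable (fun τ : ℂ ↦ g (z + τ • ξ)) 0 r ∧
        g z ≤ Real.circleAverage (fun τ : ℂ ↦ g (z + τ • ξ)) 0 r)
    (j : ℕ) (w : Fin N → ℂ) : 0 ≤ heightDensity j (φ.normed volume ⋆[lsmul ℝ ℝ, volume] g) w :=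
  heightDensity_nonneg_of_posSemidef (posSemidef_leviMatrix_normed_convolution φ hg hsmv w) j

/-- The Fubini–Study potential under small translations: `fs(w - t) ≤ fs(w) + ½ log (2 (1 + N))`
for `‖t‖_∞ ≤ 1` (from `1 + |w - t|² ≤ 2 (1 + |t|²)(1 + |w|²)`). [folklore] -/
theorem fsPotential_sub_le (w t : Fin N → ℂ) (ht : ‖t‖ ≤ 1) :
    fsPotential (w - t) ≤ fsPotential w + Real.log (2 * (1 + N)) / 2 := by
  have hS : 0 < 1 + ∑ p, ‖w p‖ ^ 2 := one_add_sum_norm_sq_pos w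
  have hT : ∑ p, ‖t p‖ ^ 2 ≤ N := by
    calc ∑ p, ‖t p‖ ^ 2 ≤ ∑ _p : Fin N, (1 : ℝ) := Finset.sum_le_sum fun p _ ↦ by
            have := (norm_le_pi_norm t p).trans ht
            nlinarith [norm_nonneg (t p)]
      _ = N := by simp
  have hkey : 1 + ∑ p, ‖(w - t) p‖ ^ 2 ≤ (2 * (1 + N)) * (1 + ∑ p, ‖w p‖ ^ 2) := by
    have h1 : ∀ p, ‖(w - t) p‖ ^ 2 ≤ 2 * ‖w p‖ ^ 2 + 2 * ‖t p‖ ^ 2 := fun p ↦ by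
      rw [Pi.sub_apply]
      have hab : ‖w p - t p‖ ^ 2 ≤ (‖w p‖ + ‖t p‖) ^ 2 :=
        pow_le_pow_left₀ (norm_nonneg _) (norm_sub_le _ _) 2
      nlinarith [sq_nonneg (‖w p‖ - ‖t p‖)]
    calc 1 + ∑ p, ‖(w - t) p‖ ^ 2 ≤ 1 + ∑ p, (2 * ‖w p‖ ^ 2 + 2 * ‖t p‖ ^ 2) := by
          gcongr with p; exact h1 p
      _ = 1 + 2 * ∑ p, ‖w p‖ ^ 2 + 2 * ∑ p, ‖t p‖ ^ 2 := by
          rw [Finset.sum_add_distrib, ← Finset.mul_sum, ← Finset.mul_sum]; ring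
      _ ≤ (2 * (1 + N)) * (1 + ∑ p, ‖w p‖ ^ 2) := by
          have : 0 ≤ ∑ p, ‖w p‖ ^ 2 := by positivity
          nlinarith
  rw [fsPotential, fsPotential, ← add_div, div_le_div_iff_of_pos_right two_pos,
    ← Real.log_mul (by positivity) (by positivity)]
  exact Real.log_le_log (one_add_sum_norm_sq_pos _) (by linarith)

/-- **Growth of mollifications**: if `g ≤ c · fs + C₀` with `c ≥ 0` and the bump has outer radius
`≤ 1`, then `ρ ⋆ g ≤ c · fs + (C₀ + c log(2(1+N))/2)`. [folklore] -/
theorem normed_convolution_le_fsPotential (φ : ContDiffBump (0 : Fin N → ℂ)) (hφ : φ.rOut ≤ 1)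
    {g : (Fin N → ℂ) → ℝ} (hg : LocallyIntegrable g volume) {c C₀ : ℝ} (hc : 0 ≤ c)
    (hle : ∀ w, g w ≤ c * fsPotential w + C₀) (x : Fin N → ℂ) :
    (φ.normed volume ⋆[lsmul ℝ ℝ, volume] g) x ≤
      c * fsPotential x + (C₀ + c * (Real.log (2 * (1 + N)) / 2)) := by
  set M : ℝ := c * fsPotential x + (C₀ + c * (Real.log (2 * (1 + N)) / 2)) with hM
  have hpt : ∀ t, φ.normed volume t * g (x - t) ≤ φ.normed volume t * M := by
    intro t
    by_cases ht : t ∈ ball (0 : Fin N → ℂ) φ.rOut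
    · refine mul_le_mul_of_nonneg_left ((hle _).trans ?_) (φ.nonneg_normed t)
      have := fsPotential_sub_le x t ((mem_ball_zero_iff.mp ht).le.trans hφ)
      rw [hM]; nlinarith
    · have h0 : φ.normed volume t = 0 := by
        have : t ∉ Function.support (φ.normed volume) := by rwa [φ.support_normed_eq]
        simpa using this
      simp [h0]
  calc (φ.normed volume ⋆[lsmul ℝ ℝ, volume] g) x = ∫ t, φ.normed volume t * g (x - t) :=
        convolution_lsmul
    _ ≤ ∫ t, φ.normed volume t * M := by
        refine integral_mono ?_ ((φ.integrable_normed).mul_const M) hpt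
        exact φ.hasCompactSupport_normed.convolutionExists_left (lsmul ℝ ℝ) φ.continuous_normed hg x
    _ = M := by
        rw [integral_mul_const, φ.integral_normed, one_mul]

end Literature.Analysis.Pluripotential

end
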